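import Mathlib.Analysis.Calculus.Deriv.MeanValue
import Mathlib.Analysis.Calculus.LocalExtr.Basic
import Mathlib.Analysis.SpecialFunctions.ExpDeriv
import Mathlib.Analysis.Real.Sqrt
import Mathlib.MeasureTheory.Integral.IntervalIntegral.FundThmCalculus
import Literature.Analysis.ODE.SchrodingerODE
import HarnessLib

/-!
# Sturm-type qualitative facts and the Picone–Jacobi identity for `u'' = q u`

Topic `Literature/Analysis/ODE` (namespace `Literature.Analysis.ODE`), continuing
`SchrodingerODE.lean`. Classical one-dimensional facts for global classical solutions
`IsSchrodingerSol q u` of `u'' = q u` (Hartman, *Ordinary Differential Equations*, Ch. XI §6–§7),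
all proved:

* `IsSchrodingerSol.eq_zero_of_isLocalMin`, `pos_of_nonneg` — a nonnegative solution vanishing at
  an interior point vanishes identically (double zero); a nonnegative solution `≢ 0` is positive.
* `IsSchrodingerSol.pos_of_nonneg_coeff` (`…_left`) — **positivity propagation / convexity**: if
  `q ≥ 0` on `[s₀, T]`, `u s₀ > 0`, `u' s₀ ≥ 0`, then `u > 0` and `u'` is nondecreasing on `[s₀, T]`
  ("the graph of a solution [...] is concave upwards when `u(t) > 0` [...] `u(t) > u(a) = 1`,
  `u'(t) ≥ u'(a) = 1`", Hartman Ch. XI, proof of Cor. 6.4); time-reversed version.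
* `IsSchrodingerSol.hasDerivAt_energy` — `(u'² - c u²)' = 2 u' (q - c) u`, with the monotonicity
  consequences `energy_antitoneOn` / `energy_monotoneOn`.
* `le_mul_exp_of_deriv_le`, `le_mul_exp_of_le_deriv` — elementary exponential bounds from the
  differential inequalities `v' ≤ -κ v`, `κ v ≤ v'`; `sqrt_mul_abs_le_abs_of_sq_le` — from
  `c v² ≤ v'²` to `√c |v| ≤ |v'|`.
* `abs_deriv_le_of_monotoneOn_of_nonpos` (`…_nonneg`) — `|u'(s+1)| ≤ u s` when `u ≥ 0`, `u' ≤ 0` and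
  `u'` is nondecreasing on `[s, s+1]` (mean value theorem); mirror image.
* `IsSchrodingerSol.picone` — the **Picone–Jacobi identity / variational principle** (Hartman
  Ch. XI, Thm. 6.2, "only if" part, with `p ≡ 1` and Hartman's `q` replaced by `-q`): if `u > 0` on
  `[a, b]` then for every `C¹` function `φ` with `φ a = φ b = 0`,
  `∫_a^b (φ'² + q φ²) = ∫_a^b (φ' - (u'/u) φ)² ≥ 0`. Contrapositive `exists_nonpos_of_integral_neg`:
  a `φ` with negative form forces every solution to be `≤ 0` somewhere on `[a, b]`.

## References

* P. Hartman, *Ordinary Differential Equations*, Classics in Applied Mathematics 38 (SIAM 2002),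
  Ch. XI §6: Thm. 6.1, Cor. 6.1, Thm. 6.2 and its proof (eqs. (6.4)–(6.7)), Cor. 6.4 and its proof.
  Key `Hartman2002`.
-/

noncomputable section

open Set Metric Filter MeasureTheory intervalIntegral
open scoped NNReal Topology

namespace Literature.Analysis.ODE

namespace IsSchrodingerSol

variable {q u : ℝ → ℝ}

/-! ## Nonnegative solutions -/

/-- A solution with a local minimum value `0` vanishes identically (the minimum is a double
zero). [cite: Hartman2002, Ch. IV Cor. 1.1] -/
theorem eq_zero_of_isLocalMin (hq : Continuous q) (hu : IsSchrodingerSol q u) {z : ℝ}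
    (hmin : IsLocalMin u z) (hz : u z = 0) : u = 0 :=
  hu.eq_zero_of_eq_zero hq hz (hmin.hasDerivAt_eq_zero (hu.hasDerivAt z))

/-- If `u ≥ 0` on a neighbourhood `[a, b]` of `z` and `u z = 0` then `u ≡ 0`. [folklore] -/
theorem eq_zero_of_nonneg_Icc (hq : Continuous q) (hu : IsSchrodingerSol q u) {a b z : ℝ}
    (hz : z ∈ Ioo a b) (h0 : ∀ s ∈ Icc a b, 0 ≤ u s) (huz : u z = 0) : u = 0 := by
  refine hu.eq_zero_of_isLocalMin hq ?_ huz
  refine IsMinOn.isLocalMin (fun s hs => ?_) (Icc_mem_nhds hz.1 hz.2)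
  rw [mem_setOf_eq, huz]
  exact h0 s hs

/-- **A nonnegative solution which is not identically zero is everywhere positive.** [folklore] -/
theorem pos_of_nonneg (hq : Continuous q) (hu : IsSchrodingerSol q u) (h0 : ∀ s, 0 ≤ u s)
    {s₁ : ℝ} (hne : u s₁ ≠ 0) (s : ℝ) : 0 < u s := by
  refine (h0 s).lt_of_ne fun hs => hne ?_
  have := hu.eq_zero_of_nonneg_Icc hq (a := s - 1) (b := s + 1) ⟨by linarith, by linarith⟩
    (fun τ _ => h0 τ) hs.symm
  simp [this]

/-! ## Positivity propagation (convexity of positive solutions when `q ≥ 0`) -/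

/-- `u'` is nondecreasing on an interval where `q u ≥ 0` (there `u'' ≥ 0`). [folklore] -/
theorem monotoneOn_deriv (hu : IsSchrodingerSol q u) {a b : ℝ}
    (h : ∀ s ∈ Ioo a b, 0 ≤ q s * u s) : MonotoneOn (deriv u) (Icc a b) := by
  refine monotoneOn_of_deriv_nonneg (convex_Icc a b) hu.continuous_deriv.continuousOn
    (hu.differentiable_deriv.differentiableOn) fun s hs => ?_
  rw [interior_Icc] at hs
  rw [hu.deriv_deriv]
  exact h s hs

/-- **Positivity propagation, forward in time.** If `q ≥ 0` on `[s₀, T]`, `u s₀ > 0` and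
`u' s₀ ≥ 0`, then `u > 0` on `[s₀, T]` (and hence, by `monotoneOn_deriv`, `u' ≥ u' s₀ ≥ 0` and `u`
is nondecreasing there): while `u > 0` the solution is convex, so `u' ≥ u'(s₀) ≥ 0` and `u` cannot
come down to `0` (Hartman Ch. XI, proof of Cor. 6.4: "the graph of a solution [...] is concave
upwards when `u(t) > 0` [...] `u(t) > u(a) = 1`, `u'(t) ≥ u'(a) = 1`").
[cite: Hartman2002, Ch. XI Cor. 6.4 (proof)] -/
theorem pos_of_nonneg_coeff (hu : IsSchrodingerSol q u) {s₀ T : ℝ}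
    (hq0 : ∀ s ∈ Icc s₀ T, 0 ≤ q s) (h0 : 0 < u s₀) (h1 : 0 ≤ deriv u s₀) :
    ∀ s ∈ Icc s₀ T, 0 < u s := by
  by_contra hcon
  push Not at hcon
  -- the first time `u ≤ 0`
  set Z : Set ℝ := {s ∈ Icc s₀ T | u s ≤ 0} with hZ
  have hZne : Z.Nonempty := by
    obtain ⟨s, hs, hus⟩ := hcon
    exact ⟨s, hs, hus⟩
  have hZbdd : BddBelow Z := ⟨s₀, fun s hs => hs.1.1⟩
  have hZclosed : IsClosed Z := by
    have : Z = Icc s₀ T ∩ u ⁻¹' Iic 0 := by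
      ext s; simp [hZ]
    rw [this]
    exact isClosed_Icc.inter (isClosed_Iic.preimage hu.continuous)
  set t₁ := sInf Z with ht₁
  have ht₁Z : t₁ ∈ Z := hZclosed.csInf_mem hZne hZbdd
  have ht₁lt : ∀ s ∈ Ico s₀ t₁, 0 < u s := by
    intro s hs
    by_contra h
    push Not at h
    have hsZ : s ∈ Z := ⟨⟨hs.1, hs.2.le.trans ht₁Z.1.2⟩, h⟩
    exact absurd (csInf_le hZbdd hsZ) (not_le.2 hs.2)
  have hs₀t₁ : s₀ < t₁ := by
    rcases eq_or_lt_of_le ht₁Z.1.1 with h | h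
    · exact absurd ht₁Z.2 (by rw [← h]; exact not_le.2 h0)
    · exact h
  -- on `[s₀, t₁]` the derivative is nondecreasing, hence `u` is nondecreasing
  have hmono : MonotoneOn (deriv u) (Icc s₀ t₁) :=
    hu.monotoneOn_deriv fun s hs =>
      mul_nonneg (hq0 s ⟨hs.1.le, hs.2.le.trans ht₁Z.1.2⟩) (ht₁lt s ⟨hs.1.le, hs.2⟩).le
  have hderiv_nonneg : ∀ s ∈ Icc s₀ t₁, 0 ≤ deriv u s := fun s hs =>
    h1.trans (hmono (left_mem_Icc.2 hs₀t₁.le) hs hs.1)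
  have humono : MonotoneOn u (Icc s₀ t₁) :=
    monotoneOn_of_deriv_nonneg (convex_Icc s₀ t₁) hu.continuous.continuousOn
      hu.differentiable.differentiableOn fun s hs => by
        rw [interior_Icc] at hs
        exact hderiv_nonneg s (Ioo_subset_Icc_self hs)
  have : u s₀ ≤ u t₁ := humono (left_mem_Icc.2 hs₀t₁.le) (right_mem_Icc.2 hs₀t₁.le) hs₀t₁.le
  linarith [ht₁Z.2]

/-- Under the hypotheses of `pos_of_nonneg_coeff`, `u'` is nondecreasing on `[s₀, T]`, so
`0 ≤ u' s₀ ≤ u' s` there. [folklore] -/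
theorem deriv_le_deriv_of_nonneg_coeff (hu : IsSchrodingerSol q u) {s₀ T : ℝ}
    (hq0 : ∀ s ∈ Icc s₀ T, 0 ≤ q s) (h0 : 0 < u s₀) (h1 : 0 ≤ deriv u s₀) :
    ∀ s ∈ Icc s₀ T, deriv u s₀ ≤ deriv u s := fun _ hs =>
  (hu.monotoneOn_deriv fun τ hτ => mul_nonneg (hq0 τ (Ioo_subset_Icc_self hτ))
    (hu.pos_of_nonneg_coeff hq0 h0 h1 τ (Ioo_subset_Icc_self hτ)).le)
    (left_mem_Icc.2 (hs.1.trans hs.2)) hs hs.1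

/-- Under the hypotheses of `pos_of_nonneg_coeff`, `u` is nondecreasing on `[s₀, T]`. [folklore] -/
theorem monotoneOn_of_nonneg_coeff (hu : IsSchrodingerSol q u) {s₀ T : ℝ}
    (hq0 : ∀ s ∈ Icc s₀ T, 0 ≤ q s) (h0 : 0 < u s₀) (h1 : 0 ≤ deriv u s₀) :
    MonotoneOn u (Icc s₀ T) :=
  monotoneOn_of_deriv_nonneg (convex_Icc s₀ T) hu.continuous.continuousOn
    hu.differentiable.differentiableOn fun s hs => by
      rw [interior_Icc] at hs
      exact h1.trans (hu.deriv_le_deriv_of_nonneg_coeff hq0 h0 h1 s (Ioo_subset_Icc_self hs))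

/-- **Positivity propagation, backward in time.** If `q ≥ 0` on `[T, s₀]`, `u s₀ > 0` and
`u' s₀ ≤ 0`, then `u > 0` on `[T, s₀]`. [folklore] -/
theorem pos_of_nonneg_coeff_left (hu : IsSchrodingerSol q u) {T s₀ : ℝ}
    (hq0 : ∀ s ∈ Icc T s₀, 0 ≤ q s) (h0 : 0 < u s₀) (h1 : deriv u s₀ ≤ 0) :
    ∀ s ∈ Icc T s₀, 0 < u s := by
  intro s hs
  have h := hu.comp_neg.pos_of_nonneg_coeff (s₀ := -s₀) (T := -T)
    (fun τ hτ => hq0 (-τ) ⟨by linarith [hτ.2], by linarith [hτ.1]⟩) (by simpa using h0)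
    (by rw [hu.deriv_comp_neg, neg_neg]; linarith) (-s) ⟨by linarith [hs.2], by linarith [hs.1]⟩
  simpa using h

/-- Backward in time, `u'` is still nondecreasing, so `u' s ≤ u' s₀ ≤ 0` on `[T, s₀]`. [folklore] -/
theorem deriv_le_deriv_of_nonneg_coeff_left (hu : IsSchrodingerSol q u) {T s₀ : ℝ}
    (hq0 : ∀ s ∈ Icc T s₀, 0 ≤ q s) (h0 : 0 < u s₀) (h1 : deriv u s₀ ≤ 0) :
    ∀ s ∈ Icc T s₀, deriv u s ≤ deriv u s₀ := fun _ hs =>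
  (hu.monotoneOn_deriv fun τ hτ => mul_nonneg (hq0 τ (Ioo_subset_Icc_self hτ))
    (hu.pos_of_nonneg_coeff_left hq0 h0 h1 τ (Ioo_subset_Icc_self hτ)).le)
    hs (right_mem_Icc.2 (hs.1.trans hs.2)) hs.2

/-! ## The energy function `u'² - c u²` -/

/-- `(u'² - c u²)' = 2 u' (q - c) u`. [folklore] -/
theorem hasDerivAt_energy (hu : IsSchrodingerSol q u) (c s : ℝ) :
    HasDerivAt (fun s => deriv u s ^ 2 - c * u s ^ 2) (2 * deriv u s * (q s - c) * u s) s := by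
  exact (((hu.hasDerivAt_deriv s).pow 2).sub (((hu.hasDerivAt s).pow 2).const_mul c)).congr_deriv
    (by norm_num; ring)

/-- Where `u ≥ 0`, `u' ≤ 0` and `q ≥ c`, the energy `u'² - c u²` is nonincreasing. [folklore] -/
theorem energy_antitoneOn (hu : IsSchrodingerSol q u) {c a b : ℝ} (h0 : ∀ s ∈ Icc a b, 0 ≤ u s)
    (h1 : ∀ s ∈ Icc a b, deriv u s ≤ 0) (hqc : ∀ s ∈ Icc a b, c ≤ q s) :
    AntitoneOn (fun s => deriv u s ^ 2 - c * u s ^ 2) (Icc a b) := by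
  refine antitoneOn_of_deriv_nonpos (convex_Icc a b)
    (fun τ _ => (hu.hasDerivAt_energy c τ).continuousAt.continuousWithinAt)
    (fun τ _ => (hu.hasDerivAt_energy c τ).differentiableAt.differentiableWithinAt) fun s hs => ?_
  rw [interior_Icc] at hs
  rw [(hu.hasDerivAt_energy c s).deriv]
  have hs' := Ioo_subset_Icc_self hs
  have : 0 ≤ -deriv u s * ((q s - c) * u s) :=
    mul_nonneg (by linarith [h1 s hs']) (mul_nonneg (by linarith [hqc s hs']) (h0 s hs'))
  nlinarith

/-- Where `u ≥ 0`, `u' ≥ 0` and `q ≥ c`, the energy `u'² - c u²` is nondecreasing. [folklore] -/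
theorem energy_monotoneOn (hu : IsSchrodingerSol q u) {c a b : ℝ} (h0 : ∀ s ∈ Icc a b, 0 ≤ u s)
    (h1 : ∀ s ∈ Icc a b, 0 ≤ deriv u s) (hqc : ∀ s ∈ Icc a b, c ≤ q s) :
    MonotoneOn (fun s => deriv u s ^ 2 - c * u s ^ 2) (Icc a b) := by
  refine monotoneOn_of_deriv_nonneg (convex_Icc a b)
    (fun τ _ => (hu.hasDerivAt_energy c τ).continuousAt.continuousWithinAt)
    (fun τ _ => (hu.hasDerivAt_energy c τ).differentiableAt.differentiableWithinAt) fun s hs => ?_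
  rw [interior_Icc] at hs
  rw [(hu.hasDerivAt_energy c s).deriv]
  have hs' := Ioo_subset_Icc_self hs
  have : 0 ≤ deriv u s * ((q s - c) * u s) :=
    mul_nonneg (h1 s hs') (mul_nonneg (by linarith [hqc s hs']) (h0 s hs'))
  nlinarith

end IsSchrodingerSol

/-! ## Elementary exponential bounds -/

/-- From `c v² ≤ w²` (`c ≥ 0`) to `√c |v| ≤ |w|`. [folklore] -/
theorem sqrt_mul_abs_le_abs_of_sq_le {c v w : ℝ} (hc : 0 ≤ c) (h : c * v ^ 2 ≤ w ^ 2) :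
    Real.sqrt c * |v| ≤ |w| := by
  have h1 : Real.sqrt (c * v ^ 2) ≤ Real.sqrt (w ^ 2) := Real.sqrt_le_sqrt h
  rwa [Real.sqrt_mul hc, Real.sqrt_sq_eq_abs, Real.sqrt_sq_eq_abs] at h1

/-- **Exponential decay from `v' ≤ -κ v`** on `[S, b]`: `v s ≤ v S · e^{-κ (s - S)}`
(`s ↦ v s e^{κ s}` is nonincreasing). [folklore] -/
theorem le_mul_exp_of_deriv_le {v : ℝ → ℝ} {κ S b : ℝ} (hv : ∀ s ∈ Icc S b, HasDerivAt v (deriv v s) s)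
    (h : ∀ s ∈ Icc S b, deriv v s ≤ -κ * v s) :
    ∀ s ∈ Icc S b, v s ≤ v S * Real.exp (-κ * (s - S)) := by
  intro s hs
  have hg : ∀ τ ∈ Icc S b, HasDerivAt (fun τ => v τ * Real.exp (κ * τ))
      (deriv v τ * Real.exp (κ * τ) + v τ * (Real.exp (κ * τ) * κ)) τ := fun τ hτ =>
    (hv τ hτ).mul ((Real.hasDerivAt_exp (κ * τ)).comp τ ((hasDerivAt_id τ).const_mul κ) |>.congr_deriv
      (by simp))
  have hanti : AntitoneOn (fun τ => v τ * Real.exp (κ * τ)) (Icc S b) := by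
    refine antitoneOn_of_deriv_nonpos (convex_Icc S b)
      (fun τ hτ => (hg τ hτ).continuousAt.continuousWithinAt)
      (fun τ hτ => (hg τ (interior_subset hτ)).differentiableAt.differentiableWithinAt) fun τ hτ => ?_
    have hτ' : τ ∈ Icc S b := interior_subset hτ
    rw [(hg τ hτ').deriv]
    have he : 0 < Real.exp (κ * τ) := Real.exp_pos _
    have := h τ hτ'
    nlinarith
  have key := hanti (left_mem_Icc.2 (hs.1.trans hs.2)) hs hs.1
  -- `v s e^{κ s} ≤ v S e^{κ S}`; multiply by `e^{-κ s}`
  have h2 := mul_le_mul_of_nonneg_right key (Real.exp_pos (-(κ * s))).le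
  simp only [mul_assoc, ← Real.exp_add, add_neg_cancel, Real.exp_zero, mul_one] at h2
  rwa [show κ * S + -(κ * s) = -κ * (s - S) by ring] at h2

/-- **Exponential bound from `κ v ≤ v'`** on `[a, S]`: `v s ≤ v S · e^{-κ (S - s)}` for `s ≤ S`
(`s ↦ v s e^{-κ s}` is nondecreasing). [folklore] -/
theorem le_mul_exp_of_le_deriv {v : ℝ → ℝ} {κ a S : ℝ} (hv : ∀ s ∈ Icc a S, HasDerivAt v (deriv v s) s)
    (h : ∀ s ∈ Icc a S, κ * v s ≤ deriv v s) :
    ∀ s ∈ Icc a S, v s ≤ v S * Real.exp (-κ * (S - s)) := by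
  intro s hs
  have hg : ∀ τ ∈ Icc a S, HasDerivAt (fun τ => v τ * Real.exp (-κ * τ))
      (deriv v τ * Real.exp (-κ * τ) + v τ * (Real.exp (-κ * τ) * -κ)) τ := fun τ hτ =>
    (hv τ hτ).mul ((Real.hasDerivAt_exp (-κ * τ)).comp τ ((hasDerivAt_id τ).const_mul (-κ))
      |>.congr_deriv (by simp))
  have hmono : MonotoneOn (fun τ => v τ * Real.exp (-κ * τ)) (Icc a S) := by
    refine monotoneOn_of_deriv_nonneg (convex_Icc a S)
      (fun τ hτ => (hg τ hτ).continuousAt.continuousWithinAt)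
      (fun τ hτ => (hg τ (interior_subset hτ)).differentiableAt.differentiableWithinAt) fun τ hτ => ?_
    have hτ' : τ ∈ Icc a S := interior_subset hτ
    rw [(hg τ hτ').deriv]
    have he : 0 < Real.exp (-κ * τ) := Real.exp_pos _
    have := h τ hτ'
    nlinarith
  have key := hmono hs (right_mem_Icc.2 (hs.1.trans hs.2)) hs.2
  have h2 := mul_le_mul_of_nonneg_right key (Real.exp_pos (κ * s)).le
  simp only [mul_assoc, ← Real.exp_add] at h2
  have h3 : -κ * s + κ * s = 0 := by ring
  rw [h3, Real.exp_zero, mul_one] at h2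
  rwa [show -κ * S + κ * s = -κ * (S - s) by ring] at h2

/-! ## Derivative bounds from monotonicity of `u'` (mean value theorem) -/

/-- If on `[s, s + 1]` the function `u` is nonnegative with `u' ≤ 0` nondecreasing, then
`|u' (s + 1)| ≤ u s`. [folklore] -/
theorem abs_deriv_le_of_monotoneOn_of_nonpos {u : ℝ → ℝ} {s : ℝ}
    (hu : ∀ τ ∈ Icc s (s + 1), HasDerivAt u (deriv u τ) τ)
    (hmono : MonotoneOn (deriv u) (Icc s (s + 1))) (h1 : deriv u (s + 1) ≤ 0) (h0 : 0 ≤ u (s + 1)) :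
    |deriv u (s + 1)| ≤ u s := by
  obtain ⟨ξ, hξ, hslope⟩ := exists_hasDerivAt_eq_slope u (deriv u) (by linarith)
    (fun τ hτ => (hu τ hτ).continuousAt.continuousWithinAt) (fun τ hτ => hu τ (Ioo_subset_Icc_self hτ))
  have hle : deriv u ξ ≤ deriv u (s + 1) :=
    hmono (Ioo_subset_Icc_self hξ) (right_mem_Icc.2 (by linarith)) hξ.2.le
  rw [add_sub_cancel_left, div_one] at hslope
  rw [abs_of_nonpos h1]
  linarith

/-- If on `[s - 1, s]` the function `u` is nonnegative with `u' ≥ 0` nondecreasing, then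
`|u' (s - 1)| ≤ u s`. [folklore] -/
theorem abs_deriv_le_of_monotoneOn_of_nonneg {u : ℝ → ℝ} {s : ℝ}
    (hu : ∀ τ ∈ Icc (s - 1) s, HasDerivAt u (deriv u τ) τ)
    (hmono : MonotoneOn (deriv u) (Icc (s - 1) s)) (h1 : 0 ≤ deriv u (s - 1)) (h0 : 0 ≤ u (s - 1)) :
    |deriv u (s - 1)| ≤ u s := by
  obtain ⟨ξ, hξ, hslope⟩ := exists_hasDerivAt_eq_slope u (deriv u) (by linarith)
    (fun τ hτ => (hu τ hτ).continuousAt.continuousWithinAt) (fun τ hτ => hu τ (Ioo_subset_Icc_self hτ))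
  have hle : deriv u (s - 1) ≤ deriv u ξ :=
    hmono (left_mem_Icc.2 (by linarith)) (Ioo_subset_Icc_self hξ) hξ.1.le
  rw [sub_sub_cancel, div_one] at hslope
  rw [abs_of_nonneg h1]
  linarith

/-! ## The Picone–Jacobi identity -/

namespace IsSchrodingerSol

variable {q u : ℝ → ℝ}

/-- **Picone–Jacobi identity / variational principle** (Hartman Ch. XI, Thm. 6.2, proof of the
"only if" part, with `p ≡ 1`; Hartman's `q` is `-q` here): if `u'' = q u` has a solution `u > 0`
on `[a, b]`, then for every `φ` of class `C¹` on `[a, b]` with `φ a = φ b = 0`,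
`∫_a^b (φ'² + q φ²) = ∫_a^b (φ' - (u'/u) φ)²`; in particular the form is `≥ 0`. Proof: with
`m = u'/u`, `m' = q - m²` and `φ'² + q φ² - (φ' - m φ)² = (m φ²)'`.
[cite: Hartman2002, Ch. XI Thm. 6.2] -/
theorem picone (hq : Continuous q) (hu : IsSchrodingerSol q u) {a b : ℝ} (hab : a ≤ b)
    (hpos : ∀ s ∈ Icc a b, 0 < u s) {φ φ' : ℝ → ℝ} (hφ : ∀ s ∈ Icc a b, HasDerivAt φ (φ' s) s)
    (hφ' : ContinuousOn φ' (Icc a b)) (ha : φ a = 0) (hb : φ b = 0) :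
    ∫ s in a..b, (φ' s ^ 2 + q s * φ s ^ 2) =
      ∫ s in a..b, (φ' s - deriv u s / u s * φ s) ^ 2 := by
  have huI : uIcc a b = Icc a b := uIcc_of_le hab
  have hφc : ContinuousOn φ (Icc a b) := fun s hs => (hφ s hs).continuousAt.continuousWithinAt
  have hmc : ContinuousOn (fun s => deriv u s / u s) (Icc a b) :=
    hu.continuous_deriv.continuousOn.div hu.continuous.continuousOn fun s hs => (hpos s hs).ne'
  -- `G = m φ²` and its derivative
  have hG : ∀ s ∈ Icc a b, HasDerivAt (fun s => deriv u s / u s * φ s ^ 2)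
      ((q s * u s * u s - deriv u s * deriv u s) / u s ^ 2 * φ s ^ 2 +
        deriv u s / u s * (2 * φ s * φ' s)) s := by
    intro s hs
    have hus : u s ≠ 0 := (hpos s hs).ne'
    have hm : HasDerivAt (fun s => deriv u s / u s)
        ((q s * u s * u s - deriv u s * deriv u s) / u s ^ 2) s :=
      (hu.hasDerivAt_deriv s).div (hu.hasDerivAt s) hus
    have hp : HasDerivAt (fun s => φ s ^ 2) (2 * φ s * φ' s) s :=
      ((hφ s hs).pow 2).congr_deriv (by norm_num)
    exact hm.mul hp
  -- the pointwise identity `φ'² + q φ² - (φ' - m φ)² = G'`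
  have hpt : ∀ s ∈ Icc a b, φ' s ^ 2 + q s * φ s ^ 2 - (φ' s - deriv u s / u s * φ s) ^ 2 =
      (q s * u s * u s - deriv u s * deriv u s) / u s ^ 2 * φ s ^ 2 +
        deriv u s / u s * (2 * φ s * φ' s) := by
    intro s hs
    have hus : u s ≠ 0 := (hpos s hs).ne'
    field_simp
    ring
  -- integrability of the three continuous integrands
  have hi1 : IntervalIntegrable (fun s => φ' s ^ 2 + q s * φ s ^ 2) volume a b := by
    refine ContinuousOn.intervalIntegrable ?_
    rw [huI]
    exact (hφ'.pow 2).add (hq.continuousOn.mul (hφc.pow 2))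
  have hi2 : IntervalIntegrable (fun s => (φ' s - deriv u s / u s * φ s) ^ 2) volume a b := by
    refine ContinuousOn.intervalIntegrable ?_
    rw [huI]
    exact (hφ'.sub (hmc.mul hφc)).pow 2
  have hi3 : IntervalIntegrable (fun s => (q s * u s * u s - deriv u s * deriv u s) / u s ^ 2 *
      φ s ^ 2 + deriv u s / u s * (2 * φ s * φ' s)) volume a b := by
    refine ContinuousOn.intervalIntegrable ?_
    rw [huI]
    refine ContinuousOn.add (ContinuousOn.mul (ContinuousOn.div ?_ (hu.continuous.continuousOn.pow 2)
      fun s hs => pow_ne_zero 2 (hpos s hs).ne') (hφc.pow 2)) (hmc.mul ?_)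
    · exact ((hq.continuousOn.mul hu.continuous.continuousOn).mul hu.continuous.continuousOn).sub
        (hu.continuous_deriv.continuousOn.mul hu.continuous_deriv.continuousOn)
    · exact (continuousOn_const.mul hφc).mul hφ'
  -- `∫ G' = G b - G a = 0`
  have hFTC : ∫ s in a..b, ((q s * u s * u s - deriv u s * deriv u s) / u s ^ 2 * φ s ^ 2 +
      deriv u s / u s * (2 * φ s * φ' s)) = 0 := by
    rw [integral_eq_sub_of_hasDerivAt (fun s hs => hG s (huI ▸ hs)) hi3, ha, hb]
    simp
  have hsub : (∫ s in a..b, (φ' s ^ 2 + q s * φ s ^ 2)) -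
      ∫ s in a..b, (φ' s - deriv u s / u s * φ s) ^ 2 = 0 := by
    rw [← integral_sub hi1 hi2, ← hFTC]
    exact integral_congr fun s hs => hpt s (huI ▸ hs)
  linarith

/-- The variational principle: a positive solution on `[a, b]` makes the form
`∫_a^b (φ'² + q φ²)` nonnegative on `C¹` functions vanishing at `a` and `b`.
[cite: Hartman2002, Ch. XI Thm. 6.2] -/
theorem integral_nonneg_of_pos (hq : Continuous q) (hu : IsSchrodingerSol q u) {a b : ℝ} (hab : a ≤ b)
    (hpos : ∀ s ∈ Icc a b, 0 < u s) {φ φ' : ℝ → ℝ} (hφ : ∀ s ∈ Icc a b, HasDerivAt φ (φ' s) s)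
    (hφ' : ContinuousOn φ' (Icc a b)) (ha : φ a = 0) (hb : φ b = 0) :
    0 ≤ ∫ s in a..b, (φ' s ^ 2 + q s * φ s ^ 2) := by
  rw [hu.picone hq hab hpos hφ hφ' ha hb]
  exact integral_nonneg hab fun s _ => sq_nonneg _

/-- **Contrapositive (Sturm–Picone):** if some `C¹` function `φ` with `φ a = φ b = 0` has
`∫_a^b (φ'² + q φ²) < 0`, then every solution of `u'' = q u` takes a value `≤ 0` somewhere on
`[a, b]` (Hartman Ch. XI, Cor. 6.1 with Thm. 6.2: the equation is not disconjugate on `[a, b]`).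
[cite: Hartman2002, Ch. XI Thm. 6.2] -/
theorem exists_nonpos_of_integral_neg (hq : Continuous q) (hu : IsSchrodingerSol q u) {a b : ℝ}
    (hab : a ≤ b) {φ φ' : ℝ → ℝ} (hφ : ∀ s ∈ Icc a b, HasDerivAt φ (φ' s) s)
    (hφ' : ContinuousOn φ' (Icc a b)) (ha : φ a = 0) (hb : φ b = 0)
    (hneg : ∫ s in a..b, (φ' s ^ 2 + q s * φ s ^ 2) < 0) : ∃ s ∈ Icc a b, u s ≤ 0 := by
  by_contra h
  push Not at h
  exact absurd hneg (not_lt.2 (hu.integral_nonneg_of_pos hq hab h hφ hφ' ha hb))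

end IsSchrodingerSol

end Literature.Analysis.ODE
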